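import Summits.BirchSwinnertonDyer.Rank1Residual.F1Sign2.FirstLayerLawAtTwoGlue
import Literature.NumberTheory.EllipticCurves.SkinnerUrban2014.PAdicUnitPeriodRatioAnyPrimeProofs
import HarnessLib

/-!
# Route ByReductionTypeAtTwo, crux `RankOneAtTwoBigImageOddLocal` (stmt-BirchSwinnertonDyer-23715), line `fkl`:
# the SIX OPEN RESIDUES of the line as closed, named `Prop`s (importable by route files; no route file imported)

Why this file exists (lead prover seat `bsd-line-fkl-p1` g5, 2026-08-28).  Two lead generations (g0, g2) reduced the crux
«BSD₂ for every non-CM `E/ℚ` of analytic rank `1` with `ρ_{E,2^n}` onto for all `n`, odd `#E(ℚ)_tors`, odd `∏ c_ℓ`» to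
ONE citation stub (five printed named facts of the tree) and SIX OPEN statements, each a single named claim, registered as
the stubs of the skeleton `Cruxes/RankOneAtTwoBigImageOddLocal/Lines/fkl.lean` (v7) and twice recommended for promotion to
items of their own (`promote-stub` notes on the item).  Until now those six statements existed only as stub SIGNATURES inside a
`Cruxes/` skeleton (not importable).  Here they are stated VERBATIM (the registered v7 signatures, character for character)
as closed `@[conjecture] def … : Prop`s, so that (i) a route file may import this module and name them as items / crux
children (the route's own `OrdHalvesDefs` pattern), (ii) the companion proof file `…FklAssembly` can state the kernel-checked
implication «five printed facts ∧ these six ⟹ `RankOneAtTwoBigImageOddLocal`» BY NAME, and (iii) the skeleton's stubs become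
one-line citations of these names.  Nothing is asserted; no new object (every body is a statement over tree symbols:
`IsLevelAtTwo`, `levelSumTwo`, `InTwoPowZLoc`, `PeriodTransferAtTwo`, `IsNewformOf`, `shaAn`, `ModularParametrizationData`,
`periodLattice`); `Iff.rfl` lemmas record that the K2-F / K2-F_an laws of the tree are not restated but REFINED (their open
residues only).  This module imports NO Theses file (no glue.cyclic-import).  BSD is not proved by any of this.

Dictionary (line card `Lines/fkl.md`, lead reports `FklLeadReportG0.md` / `FklLeadReportG2.md` on the crux directory):
* (2a) `FirstLayerHigherCongruenceAtTwo` (HC) and (2b) `FirstLayerNonVanishingAtTwo` (NV): K2-F `F1Sign2.FirstLayerLawAtTwo`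
  ⟺ HC ∧ NV (Theorems `…FklResidues.firstLayerLawAtTwo_of_residues` / `residues_of_firstLayerLawAtTwo`, p596672; the rows with
  `min(k, s+1) = 1` are the THEOREM `…FklClauseA.firstLayerLawAtTwo_clauseA_mod_two`, p595057).
* (3a) `AnalyticFirstLayerHigherCongruenceAtTwo` (HC_an) and (3b) `AnalyticFirstLayerNonVanishingAtTwo` (NV_an):
  K2-F_an `F1Sign2.AnalyticFirstLayerLawAtTwo` ⟺ HC_an ∧ NV_an (same file).
* (4) `ManinOddAdditiveAtTwo`: Manin's conjecture ⊗ ℤ₂ at additive level (`4 ∣ N`); with Abbes–Ullmo (`2 ∤ N`) and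
  Česnavičius 2018 (`2 ∥ N`) it gives the period transfer at `2` on the whole slice (skeleton `periodTransferOnSlice_of_stubs`).
* (5) `ShaAnTwoIntegralOnBigImageSlice`: `Ш_an` is a `2`-adic integer on the slice in analytic rank one — NECESSARY
  (`…FklLossless.stub_shaAnTwoIntegralOnSlice_of_crux`, p592053).
-/

set_option autoImplicit false

noncomputable section

open scoped Classical MatrixGroups ModularForm

set_option linter.dupNamespace false

namespace Summit.BirchSwinnertonDyer.BirchSwinnertonDyer.Theorems.RankOneAtTwoFkl

open CongruenceSubgroup WeierstrassCurve Literature.NumberTheory.EllipticCurves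
  Literature.NumberTheory.EllipticCurves.ModularForms Summit.BirchSwinnertonDyer.Rank1Residual.F1Sign2

/-! ## (2a)/(2b) — the open residues of K2-F `F1Sign2.FirstLayerLawAtTwo` -/

/-- **(HC) the HIGHER CONGRUENCE of the first Kolyvagin layer at `2`** — the open residue of clause (a) of K2-F
`F1Sign2.FirstLayerLawAtTwo` (registered stub `stub_firstLayerHigherCongruence` of `Lines/fkl.lean` v7, verbatim): under K2-F's
own binders (globally minimal `W`, newform `f` with the period transfer at `2`, `ρ_{W,2^n}` onto for all `n`, odd torsion,
odd Tamagawa product, `w = −1`, Mordell–Weil rank `1`, `Ш[2^∞]` finite, `s := ord₂ #Ш[2^∞]`), for `s ≥ 1` EVERY row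
`(ℓ, k, ψ)` of the first layer with level `k ≥ 2` has `δ'_k(ℓ; ψ) ∈ 2^{min(k, s+1)} ℤ_{(2)}`.  Kolyvagin direction («a large
`Ш[2^∞]` forces `2`-divisibility of the derivative classes»); in print only for `p` odd (Mazur–Rubin 2004 Thm 5.2.12, Kim,
Amer. J. Math. 2026 = arXiv:2203.12159 Thm 1.1, `p ≥ 5`).  OPEN at `p = 2`; nothing asserted.
[cite: MazurRubin2004, Thm. 5.2.12 (p odd; shape only; nothing asserted)] -/
@[conjecture] def FirstLayerHigherCongruenceAtTwo : Prop :=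
  ∀ (W : WeierstrassCurve ℚ) [W.IsElliptic] [W.IsGloballyMinimal] {M : ℕ} [NeZero M]
    (f : CuspForm (Gamma0 M) 2), IsNewformOf W f → PeriodTransferAtTwo W f →
    (∀ n : ℕ, W.HasSurjectiveModNGaloisRep ((2 ^ n : ℕ) : ℤ)) → Odd W.torsionOrder → Odd W.tamagawaProduct →
    W.rootNumber = -1 → W.mordellWeilRank = 1 → Finite (AddCommGroup.primaryComponent W.sha 2) →
    let s := padicValNat 2 (Nat.card (AddCommGroup.primaryComponent W.sha 2))
    1 ≤ s → ∀ (ℓ k : ℕ) [Fact ℓ.Prime], IsLevelAtTwo W ℓ → 2 ≤ k → (2 ^ k : ℤ) ∣ (ℓ : ℤ) - 1 →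
      (2 ^ k : ℤ) ∣ W.frobeniusTrace ℓ - 2 →
      ∀ ψ : (ZMod ℓ)ˣ →* Multiplicative (ZMod (2 ^ k)), Function.Surjective ψ →
        InTwoPowZLoc (min k (s + 1)) (levelSumTwo f ℓ k ψ)

/-- **(NV) the NON-VANISHING of the first Kolyvagin layer at `2`** — clause (b) of K2-F `F1Sign2.FirstLayerLawAtTwo` under its
own binders (registered stub `stub_firstLayerNonVanishing` of `Lines/fkl.lean` v7, verbatim): SOME `τ`-prime `ℓ` of level
`k ≥ s + 2` and some surjective `ψ : (ℤ/ℓ)ˣ → ℤ/2^k` have `δ'_k(ℓ; ψ) ∉ 2^{s+2} ℤ_{(2)}` — Kolyvagin NON-TRIVIALITY at `2` with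
the exact exponent (the algebraic analogue of Kolyvagin's conjecture, W. Zhang, Camb. J. Math. 2 (2014) Thm 1.1, whose printed
form needs `p ≥ 5`).  For `s = 0` it is implied by ONE `τ`-prime `ℓ ≡ 1 (4)`, `4 ∣ a_ℓ − 2`, with
`L(E^{(ℓ)},1)/Ω(E^{(ℓ)}) ∉ 4ℤ_{(2)}` (Theorems `…FklTwistLValue`, p599166).  OPEN at `p = 2`; nothing asserted.
[cite: Zhang2014CJM, Thm. 1.1 (p ≥ 5; shape only; nothing asserted)] -/
@[conjecture] def FirstLayerNonVanishingAtTwo : Prop :=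
  ∀ (W : WeierstrassCurve ℚ) [W.IsElliptic] [W.IsGloballyMinimal] {M : ℕ} [NeZero M]
    (f : CuspForm (Gamma0 M) 2), IsNewformOf W f → PeriodTransferAtTwo W f →
    (∀ n : ℕ, W.HasSurjectiveModNGaloisRep ((2 ^ n : ℕ) : ℤ)) → Odd W.torsionOrder → Odd W.tamagawaProduct →
    W.rootNumber = -1 → W.mordellWeilRank = 1 → Finite (AddCommGroup.primaryComponent W.sha 2) →
    let s := padicValNat 2 (Nat.card (AddCommGroup.primaryComponent W.sha 2))
    ∃ (ℓ k : ℕ) (_ : Fact ℓ.Prime) (ψ : (ZMod ℓ)ˣ →* Multiplicative (ZMod (2 ^ k))),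
      IsLevelAtTwo W ℓ ∧ s + 2 ≤ k ∧ (2 ^ k : ℤ) ∣ (ℓ : ℤ) - 1 ∧ (2 ^ k : ℤ) ∣ W.frobeniusTrace ℓ - 2 ∧
      Function.Surjective ψ ∧ ¬ InTwoPowZLoc (s + 2) (levelSumTwo f ℓ k ψ)

/-! ## (3a)/(3b) — the open residues of K2-F_an `F1Sign2.AnalyticFirstLayerLawAtTwo` -/

/-- **(HC_an) the HIGHER CONGRUENCE of the analytic first-layer law at `2`** — the open residue of clause (a) of K2-F_an
`F1Sign2.AnalyticFirstLayerLawAtTwo` under its own binders (analytic rank `1`, `Ш_an = q ∈ ℚ^×`, `s_an := (ord₂ q).toNat`;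
registered stub `stub_analyticFirstLayerHigherCongruence` of `Lines/fkl.lean` v7, verbatim): for `s_an ≥ 1` every
first-layer row of level `k ≥ 2` has `δ'_k(ℓ; ψ) ∈ 2^{min(k, s_an+1)} ℤ_{(2)}`.  A statement about modular symbols, `L'(E,1)`
and the regulator only (Mazur–Tate-type divisibility of the first layer by the ANALYTIC order of `Ш`); what the cell's tables
DES9–DES11 test row by row (0 violations / 17 572 level checks).  OPEN; nothing asserted.
[cite: MazurRubin2004, Thm. 5.2.12 (p odd; shape only; nothing asserted)] -/
@[conjecture] def AnalyticFirstLayerHigherCongruenceAtTwo : Prop :=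
  ∀ (W : WeierstrassCurve ℚ) [W.IsElliptic] [W.IsGloballyMinimal] {M : ℕ} [NeZero M]
    (f : CuspForm (Gamma0 M) 2), IsNewformOf W f → PeriodTransferAtTwo W f →
    (∀ n : ℕ, W.HasSurjectiveModNGaloisRep ((2 ^ n : ℕ) : ℤ)) → Odd W.torsionOrder → Odd W.tamagawaProduct →
    W.rootNumber = -1 → W.analyticRank = 1 →
    ∀ q : ℚ, shaAn W = (q : ℂ) → q ≠ 0 →
    let s := (padicValRat 2 q).toNat
    1 ≤ s → ∀ (ℓ k : ℕ) [Fact ℓ.Prime], IsLevelAtTwo W ℓ → 2 ≤ k → (2 ^ k : ℤ) ∣ (ℓ : ℤ) - 1 →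
      (2 ^ k : ℤ) ∣ W.frobeniusTrace ℓ - 2 →
      ∀ ψ : (ZMod ℓ)ˣ →* Multiplicative (ZMod (2 ^ k)), Function.Surjective ψ →
        InTwoPowZLoc (min k (s + 1)) (levelSumTwo f ℓ k ψ)

/-- **(NV_an) the NON-VANISHING of the analytic first-layer law at `2`** — clause (b) of K2-F_an
`F1Sign2.AnalyticFirstLayerLawAtTwo` under its own binders (registered stub `stub_analyticFirstLayerNonVanishing` of
`Lines/fkl.lean` v7, verbatim): some `τ`-prime of level `k ≥ s_an + 2` and some surjective `ψ` have
`δ'_k(ℓ; ψ) ∉ 2^{s_an+2} ℤ_{(2)}` — ANALYTIC non-vanishing of a first-layer modular-symbol sum at the exponent predicted by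
`Ш_an` (the analytic analogue of Kolyvagin's conjecture at `2`; DES9–DES11 witness it on 286/286 + 2 219 uncensored rows).
OPEN; nothing asserted. [cite: Zhang2014CJM, Thm. 1.1 (p ≥ 5; shape only; nothing asserted)] -/
@[conjecture] def AnalyticFirstLayerNonVanishingAtTwo : Prop :=
  ∀ (W : WeierstrassCurve ℚ) [W.IsElliptic] [W.IsGloballyMinimal] {M : ℕ} [NeZero M]
    (f : CuspForm (Gamma0 M) 2), IsNewformOf W f → PeriodTransferAtTwo W f →
    (∀ n : ℕ, W.HasSurjectiveModNGaloisRep ((2 ^ n : ℕ) : ℤ)) → Odd W.torsionOrder → Odd W.tamagawaProduct →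
    W.rootNumber = -1 → W.analyticRank = 1 →
    ∀ q : ℚ, shaAn W = (q : ℂ) → q ≠ 0 →
    let s := (padicValRat 2 q).toNat
    ∃ (ℓ k : ℕ) (_ : Fact ℓ.Prime) (ψ : (ZMod ℓ)ˣ →* Multiplicative (ZMod (2 ^ k))),
      IsLevelAtTwo W ℓ ∧ s + 2 ≤ k ∧ (2 ^ k : ℤ) ∣ (ℓ : ℤ) - 1 ∧ (2 ^ k : ℤ) ∣ W.frobeniusTrace ℓ - 2 ∧
      Function.Surjective ψ ∧ ¬ InTwoPowZLoc (s + 2) (levelSumTwo f ℓ k ψ)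

/-! ## (4) — Manin's conjecture ⊗ ℤ₂ at additive level -/

/-- **Manin's conjecture ⊗ ℤ₂ at ADDITIVE level** (registered stub `stub_maninOddAdditiveAtTwo` of `Lines/fkl.lean` v7,
verbatim): for every globally minimal elliptic `W₀/ℚ` and every LATTICE-OPTIMAL parametrisation datum `D₀` at a level `N` with
`4 ∣ N` (`Λ_{W₀} ⊆ c·Λ_f`, i.e. `φ` is the optimal parametrisation of the strong Weil curve), the Manin constant is ODD.  Same
shape as its two PRINTED neighbours in `ManinConstantSemistablePrimewise.lean` (Abbes–Ullmo Thm A: `p ∤ N ⇒ p ∤ c`;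
Česnavičius 2018 Thm 1.2: `2 ∥ N ⇒ 2 ∤ c`), which cover `4 ∤ N`; for `4 ∣ N` print has only `v₂(c_φ) ≤ v₂(deg φ)` (+1 when
`8 ∣ N` and no prime `p' ≡ 3 (4)` divides `N`) (Česnavičius–Neururer–Saha, JEMS = arXiv:1911.09446 Thm 1.2) and `c = 1` for
every optimal curve of conductor `≤ 500 000` (Cremona) — conjecture-grade (Manin 1972 §5: `c = 1`).  OPEN; nothing asserted.
[cite: Manin1972, §5 (conjecture; shape only; nothing asserted)] [cite: Cesnavicius2018, Thm. 1.2 (the `2 ∥ N` neighbour)] -/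
@[conjecture] def ManinOddAdditiveAtTwo : Prop :=
  ∀ (W₀ : WeierstrassCurve ℚ) [W₀.IsElliptic] [W₀.IsGloballyMinimal] {N : ℕ} [NeZero N]
    (D₀ : ModularParametrizationData W₀ N),
    (∀ z ∈ D₀.L.lattice, ∃ w ∈ periodLattice D₀.f, z = D₀.c * w) → 2 ^ 2 ∣ N → ¬ (2 : ℤ) ∣ D₀.maninConstant

/-! ## (5) — `Ш_an` is a `2`-adic integer on the slice -/

/-- **`Ш_an` is `2`-INTEGRAL on the big-image odd-local slice in analytic rank one** (registered stub
`stub_shaAnTwoIntegralOnSlice` of `Lines/fkl.lean` v7, verbatim): for every non-CM globally minimal `W` with `ρ_{W,2^n}` onto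
for all `n`, odd torsion, odd Tamagawa product and analytic rank `1`, any rational value `q` of `Ш_an(W)` has `ord₂ q ≥ 0`.
OPEN in the ∀-form and NECESSARY for the crux (`BSDp W 2 ⟹` it: Theorems `…FklLossless.stub_shaAnTwoIntegralOnSlice_of_crux`);
= «the Gross–Zagier constant `c_E` is `2`-integral» (Theorems `…StubShaAnRationalOnSlice`, p592406); theorem-level instances in
print: Miller 2011 Thm 7.1 (`N < 5000`), Kriz–Li 2019 Thm 5.1.  Nothing asserted.
[cite: Miller2011LMS, Thm. 7.1 (instances N < 5000; shape only; nothing asserted)] -/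
@[conjecture] def ShaAnTwoIntegralOnBigImageSlice : Prop :=
  ∀ (W : WeierstrassCurve ℚ) [W.IsElliptic] [W.IsGloballyMinimal], ¬ W.HasCM →
    (∀ n : ℕ, W.HasSurjectiveModNGaloisRep ((2 ^ n : ℕ) : ℤ)) → Odd W.torsionOrder → Odd W.tamagawaProduct →
    W.analyticRank = 1 → ∀ q : ℚ, shaAn W = (q : ℂ) → 0 ≤ padicValRat 2 q

/-! ## Bookkeeping: the four first-layer residues are exactly the clauses of the tree's two laws -/

/-- Bookkeeping: K2-F `F1Sign2.FirstLayerLawAtTwo` IS «clause (a) at every row» ∧ (NV) under the same binders — (NV) is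
literally its clause (b) (the `Iff` is by `rfl` on the second components). [folklore] -/
theorem firstLayerLawAtTwo_iff_clauseA_and_nonVanishing : FirstLayerLawAtTwo ↔
    ∀ (W : WeierstrassCurve ℚ) [W.IsElliptic] [W.IsGloballyMinimal] {M : ℕ} [NeZero M]
      (f : CuspForm (Gamma0 M) 2), IsNewformOf W f → PeriodTransferAtTwo W f →
      (∀ n : ℕ, W.HasSurjectiveModNGaloisRep ((2 ^ n : ℕ) : ℤ)) → Odd W.torsionOrder → Odd W.tamagawaProduct →
      W.rootNumber = -1 → W.mordellWeilRank = 1 → Finite (AddCommGroup.primaryComponent W.sha 2) →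
      let s := padicValNat 2 (Nat.card (AddCommGroup.primaryComponent W.sha 2))
      (∀ (ℓ k : ℕ) [Fact ℓ.Prime], IsLevelAtTwo W ℓ → 1 ≤ k → (2 ^ k : ℤ) ∣ (ℓ : ℤ) - 1 →
          (2 ^ k : ℤ) ∣ W.frobeniusTrace ℓ - 2 →
          ∀ ψ : (ZMod ℓ)ˣ →* Multiplicative (ZMod (2 ^ k)), Function.Surjective ψ →
            InTwoPowZLoc (min k (s + 1)) (levelSumTwo f ℓ k ψ)) ∧
      (∃ (ℓ k : ℕ) (_ : Fact ℓ.Prime) (ψ : (ZMod ℓ)ˣ →* Multiplicative (ZMod (2 ^ k))),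
          IsLevelAtTwo W ℓ ∧ s + 2 ≤ k ∧ (2 ^ k : ℤ) ∣ (ℓ : ℤ) - 1 ∧ (2 ^ k : ℤ) ∣ W.frobeniusTrace ℓ - 2 ∧
          Function.Surjective ψ ∧ ¬ InTwoPowZLoc (s + 2) (levelSumTwo f ℓ k ψ)) :=
  Iff.rfl

/-- Bookkeeping: (NV) is implied by K2-F (it is its clause (b), row for row). [folklore] -/
theorem firstLayerNonVanishingAtTwo_of_firstLayerLawAtTwo (hF : FirstLayerLawAtTwo) :
    FirstLayerNonVanishingAtTwo := by
  intro W _ _ M _ f hf hper hsurj hT hc hw hr hfin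
  exact (hF W f hf hper hsurj hT hc hw hr hfin).2

/-- Bookkeeping: (HC) is implied by K2-F (its clause (a) restricted to `s ≥ 1`, `k ≥ 2`). [folklore] -/
theorem firstLayerHigherCongruenceAtTwo_of_firstLayerLawAtTwo (hF : FirstLayerLawAtTwo) :
    FirstLayerHigherCongruenceAtTwo := by
  intro W _ _ M _ f hf hper hsurj hT hc hw hr hfin
  have HF := hF W f hf hper hsurj hT hc hw hr hfin
  simp only at HF ⊢
  intro _hs ℓ k _ hlev hk hℓk ha ψ hψ
  exact HF.1 ℓ k hlev (by omega) hℓk ha ψ hψ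

/-- Bookkeeping: (NV_an) is implied by K2-F_an (its clause (b)). [folklore] -/
theorem analyticFirstLayerNonVanishingAtTwo_of_analyticFirstLayerLawAtTwo (hA : AnalyticFirstLayerLawAtTwo) :
    AnalyticFirstLayerNonVanishingAtTwo := by
  intro W _ _ M _ f hf hper hsurj hT hc hw han q hq hq0
  exact (hA W f hf hper hsurj hT hc hw han q hq hq0).2

/-- Bookkeeping: (HC_an) is implied by K2-F_an (its clause (a) restricted to `s_an ≥ 1`, `k ≥ 2`). [folklore] -/
theorem analyticFirstLayerHigherCongruenceAtTwo_of_analyticFirstLayerLawAtTwo (hA : AnalyticFirstLayerLawAtTwo) :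
    AnalyticFirstLayerHigherCongruenceAtTwo := by
  intro W _ _ M _ f hf hper hsurj hT hc hw han q hq hq0
  have HA := hA W f hf hper hsurj hT hc hw han q hq hq0
  simp only at HA ⊢
  intro _hs ℓ k _ hlev hk hℓk ha ψ hψ
  exact HA.1 ℓ k hlev (by omega) hℓk ha ψ hψ

/-! ## APPEND (lead bsd-line-fkl-p1 g5, second filing): the LEVEL-TWO SHADOWS of the four first-layer residues —
statements about PRIME QUADRATIC TWISTS only (`T_ℓ(f) = twistSymbolSum f ℓ = L(E^{(ℓ)},1)/Ω(E^{(ℓ)})` modulo `4`)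

On the two half-slices `{Ш(E)[2] = 0}` and `{Ш_an(E) odd}` of the crux only first-layer rows of LEVEL `2` are load-bearing (companion
proof file `…FklTwistParity`: the level shift of `…FklLevelShift` / `…FklFirstNonVanishingLevel` reduces every row to level `2`, and
level `2` is `T_ℓ(f) mod 4`).  The four statements below are those level-`2` rows in quadratic-twist currency; each is IMPLIED by the
corresponding residue above (proved in `…FklTwistParity`), and together with the printed facts, `ManinOddAdditiveAtTwo` and
`ShaAnTwoIntegralOnBigImageSlice` they give `BSDp W 2` on `{Ш[2] = 0}` (from `LevelTwoTwistNonVanishingAtTwo` ∧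
`AnalyticLevelTwoTwistCongruenceAtTwo`) and on `{Ш_an odd}` (from `LevelTwoTwistCongruenceAtTwo` ∧
`AnalyticLevelTwoTwistNonVanishingAtTwo`).  A `τ`-prime of level `≥ 2` is a prime `ℓ` with `IsLevelAtTwo W ℓ` (`ℓ ∤ 2N`,
`#E(𝔽_ℓ)[2] = 2`), `4 ∣ ℓ − 1` and `4 ∣ a_ℓ − 2`.  Nothing asserted. -/

/-- **(L2-NV) level-two twist NON-VANISHING, algebraic side** — the `s = 0` case of (NV) `FirstLayerNonVanishingAtTwo` in
quadratic-twist currency: under K2-F's binders, if `Ш(E)[2^∞]` is trivial then SOME `τ`-prime `ℓ` of level `≥ 2` has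
`T_ℓ(f) ∉ 4ℤ_{(2)}` («some prime quadratic twist `E^{(ℓ)}`, `ℓ ≡ 1 (4)`, `4 ∣ a_ℓ − 2`, has `L(E^{(ℓ)},1)/Ω(E^{(ℓ)}) ≡ 2 (mod 4)`»).
EQUIVALENT to (NV) on `{Ш[2] = 0}` (`…FklTwistParity`).  By 2-descent + rank-0 BSD₂ of the twist this is «a Kummer `τ`-prime exists»;
OPEN as stated (the rank-0 `2`-converse for `E^{(ℓ)}` is not in print).  Nothing asserted.
[cite: Zhang2014CJM, Thm. 1.1 (p ≥ 5; shape only; nothing asserted)] -/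
@[conjecture] def LevelTwoTwistNonVanishingAtTwo : Prop :=
  ∀ (W : WeierstrassCurve ℚ) [W.IsElliptic] [W.IsGloballyMinimal] {M : ℕ} [NeZero M]
    (f : CuspForm (Gamma0 M) 2), IsNewformOf W f → PeriodTransferAtTwo W f →
    (∀ n : ℕ, W.HasSurjectiveModNGaloisRep ((2 ^ n : ℕ) : ℤ)) → Odd W.torsionOrder → Odd W.tamagawaProduct →
    W.rootNumber = -1 → W.mordellWeilRank = 1 → Finite (AddCommGroup.primaryComponent W.sha 2) →
    Nat.card (AddCommGroup.primaryComponent W.sha 2) = 1 →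
    ∃ (ℓ : ℕ) (_ : Fact ℓ.Prime), IsLevelAtTwo W ℓ ∧ (2 ^ 2 : ℤ) ∣ (ℓ : ℤ) - 1 ∧ (2 ^ 2 : ℤ) ∣ W.frobeniusTrace ℓ - 2 ∧
      ¬ InTwoPowZLoc 2 (twistSymbolSum f ℓ)

/-- **(L2-HC) level-two twist CONGRUENCE, algebraic side** — the level-`2` rows of (HC) `FirstLayerHigherCongruenceAtTwo` in
quadratic-twist currency: under K2-F's binders, if `2 ∣ #Ш(E)[2^∞]` (`s ≥ 1`) then EVERY `τ`-prime `ℓ` of level `≥ 2` has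
`T_ℓ(f) ∈ 4ℤ_{(2)}` («`Ш(E)[2] ≠ 0 ⇒ 4 ∣ L^{alg}(E^{(ℓ)},1)` for every such prime twist»).  IMPLIED by (HC); by 2-descent it is the
Kato upper bound at `2` for the rank-0 twists.  OPEN as stated; nothing asserted.
[cite: MazurRubin2004, Thm. 5.2.12 (p odd; shape only; nothing asserted)] -/
@[conjecture] def LevelTwoTwistCongruenceAtTwo : Prop :=
  ∀ (W : WeierstrassCurve ℚ) [W.IsElliptic] [W.IsGloballyMinimal] {M : ℕ} [NeZero M]
    (f : CuspForm (Gamma0 M) 2), IsNewformOf W f → PeriodTransferAtTwo W f →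
    (∀ n : ℕ, W.HasSurjectiveModNGaloisRep ((2 ^ n : ℕ) : ℤ)) → Odd W.torsionOrder → Odd W.tamagawaProduct →
    W.rootNumber = -1 → W.mordellWeilRank = 1 → Finite (AddCommGroup.primaryComponent W.sha 2) →
    1 ≤ padicValNat 2 (Nat.card (AddCommGroup.primaryComponent W.sha 2)) →
    ∀ (ℓ : ℕ) [Fact ℓ.Prime], IsLevelAtTwo W ℓ → (2 ^ 2 : ℤ) ∣ (ℓ : ℤ) - 1 → (2 ^ 2 : ℤ) ∣ W.frobeniusTrace ℓ - 2 →
      InTwoPowZLoc 2 (twistSymbolSum f ℓ)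

/-- **(L2-NV_an) level-two twist NON-VANISHING, analytic side** — the `s_an = 0` case of (NV_an)
`AnalyticFirstLayerNonVanishingAtTwo` in quadratic-twist currency: under K2-F_an's binders (analytic rank `1`, `Ш_an = q ∈ ℚ^×`), if
`ord₂ q ≤ 0` then SOME `τ`-prime `ℓ` of level `≥ 2` has `T_ℓ(f) ∉ 4ℤ_{(2)}` («`Ш_an(E)` odd ⇒ some prime quadratic twist has
`L^{alg}(E^{(ℓ)},1) ≡ 2 (mod 4)`»).  EQUIVALENT to (NV_an) on `{ord₂ Ш_an ≤ 0}`.  A statement about `L'(E,1)`, the regulator and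
central values of prime quadratic twists only; OPEN; nothing asserted.
[cite: Zhang2014CJM, Thm. 1.1 (p ≥ 5; shape only; nothing asserted)] -/
@[conjecture] def AnalyticLevelTwoTwistNonVanishingAtTwo : Prop :=
  ∀ (W : WeierstrassCurve ℚ) [W.IsElliptic] [W.IsGloballyMinimal] {M : ℕ} [NeZero M]
    (f : CuspForm (Gamma0 M) 2), IsNewformOf W f → PeriodTransferAtTwo W f →
    (∀ n : ℕ, W.HasSurjectiveModNGaloisRep ((2 ^ n : ℕ) : ℤ)) → Odd W.torsionOrder → Odd W.tamagawaProduct →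
    W.rootNumber = -1 → W.analyticRank = 1 →
    ∀ q : ℚ, shaAn W = (q : ℂ) → q ≠ 0 → padicValRat 2 q ≤ 0 →
    ∃ (ℓ : ℕ) (_ : Fact ℓ.Prime), IsLevelAtTwo W ℓ ∧ (2 ^ 2 : ℤ) ∣ (ℓ : ℤ) - 1 ∧ (2 ^ 2 : ℤ) ∣ W.frobeniusTrace ℓ - 2 ∧
      ¬ InTwoPowZLoc 2 (twistSymbolSum f ℓ)

/-- **(L2-HC_an) level-two twist CONGRUENCE, analytic side** — the level-`2` rows of (HC_an)
`AnalyticFirstLayerHigherCongruenceAtTwo` in quadratic-twist currency: under K2-F_an's binders, if `ord₂ q ≥ 1` (`Ш_an(E)` even) then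
EVERY `τ`-prime `ℓ` of level `≥ 2` has `T_ℓ(f) ∈ 4ℤ_{(2)}` («`2 ∣ Ш_an(E) ⇒ 4 ∣ L^{alg}(E^{(ℓ)},1)` for every such prime twist»).
IMPLIED by (HC_an); what the cell's tables DES9–DES11 / REF1 §56 test at level `2` (0 violations).  OPEN; nothing asserted.
[cite: MazurRubin2004, Thm. 5.2.12 (p odd; shape only; nothing asserted)] -/
@[conjecture] def AnalyticLevelTwoTwistCongruenceAtTwo : Prop :=
  ∀ (W : WeierstrassCurve ℚ) [W.IsElliptic] [W.IsGloballyMinimal] {M : ℕ} [NeZero M]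
    (f : CuspForm (Gamma0 M) 2), IsNewformOf W f → PeriodTransferAtTwo W f →
    (∀ n : ℕ, W.HasSurjectiveModNGaloisRep ((2 ^ n : ℕ) : ℤ)) → Odd W.torsionOrder → Odd W.tamagawaProduct →
    W.rootNumber = -1 → W.analyticRank = 1 →
    ∀ q : ℚ, shaAn W = (q : ℂ) → q ≠ 0 → 1 ≤ (padicValRat 2 q).toNat →
    ∀ (ℓ : ℕ) [Fact ℓ.Prime], IsLevelAtTwo W ℓ → (2 ^ 2 : ℤ) ∣ (ℓ : ℤ) - 1 → (2 ^ 2 : ℤ) ∣ W.frobeniusTrace ℓ - 2 →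
      InTwoPowZLoc 2 (twistSymbolSum f ℓ)

end Summit.BirchSwinnertonDyer.BirchSwinnertonDyer.Theorems.RankOneAtTwoFkl

end
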